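import Literature.Probability.Percolation.OneArmLSW
import HarnessLib

/-!
# Line `Sketch` — crux 5 ⟹ crux 6, analysis stub: the exponent `-β` from two-sided one-step
# block estimates along geometric scales (crux stmt-CriticalPhenomena-5661)

Pure real analysis, no percolation. Let `θ : ℕ → ℝ` be positive, `≤ 1` and antitone, and suppose
that for every `δ > 0` there are a scale `Λ ≥ 2`, a threshold `k₀` and one-step bounds along the
geometric chain `Λ^k`, `k ≥ k₀`:

* `θ(Λ^(k+1)) ≤ q · θ(Λ^k)` with `log q ≤ (-β + δ) log Λ`, resp.
* `b · θ(Λ^k) ≤ θ(Λ^(k+1))` with `(-β - δ) log Λ ≤ log b`, `0 < b ≤ 1`.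

Then `log θ(n) / log n → -β` (`stub_exponentOfBlocks`). Iterating the one-step bounds gives the
geometric bounds `θ(Λ^(k₀+m)) ≤ q^m` and `b^m θ(Λ^k₀) ≤ θ(Λ^(k₀+m))`; monotonicity of `θ`
transfers them to every `n ≥ 1` through `Λ^⌊log n / log Λ - k₀⌋₊ + k₀ ≤ n ≤ Λ^⌈log n / log Λ⌉₊`,
and the two eventual bounds on `log θ(n) / log n` are then the model-free LSW §3 lemmas
`eventually_log_div_log_lt_of_geometric` / `eventually_lt_log_div_log_of_geometric` of
`Literature.Probability.Percolation.OneArmLSW`.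
-/

noncomputable section

namespace Summit.CriticalPhenomena.CardyFormulaZ2.Cruxes.HalfPlaneMarkDensityLaw.SketchLine

open Literature.Probability.Percolation Filter Set
open scoped Topology

namespace OneArm

/-! ## Iterating the one-step bounds -/

/-- Upper iteration: `θ(Λ^(k+1)) ≤ q θ(Λ^k)` for `k ≥ k₀` (`q ≥ 0`) gives
`θ(Λ^(k₀+m)) ≤ q^m θ(Λ^k₀)` for every `m`. [folklore] -/
private theorem stub_exponentOfBlocks_aux_iterUpper {θ : ℕ → ℝ} {Λ k₀ : ℕ} {q : ℝ} (hq : 0 ≤ q)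
    (h : ∀ k : ℕ, k₀ ≤ k → θ (Λ ^ (k + 1)) ≤ q * θ (Λ ^ k)) (m : ℕ) :
    θ (Λ ^ (k₀ + m)) ≤ q ^ m * θ (Λ ^ k₀) := by
  induction m with
  | zero => simp
  | succ m ih =>
    calc θ (Λ ^ (k₀ + (m + 1))) = θ (Λ ^ (k₀ + m + 1)) := by rw [add_assoc]
      _ ≤ q * θ (Λ ^ (k₀ + m)) := h _ (Nat.le_add_right _ _)
      _ ≤ q * (q ^ m * θ (Λ ^ k₀)) := mul_le_mul_of_nonneg_left ih hq
      _ = q ^ (m + 1) * θ (Λ ^ k₀) := by rw [pow_succ]; ring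

/-- Lower iteration: `b θ(Λ^k) ≤ θ(Λ^(k+1))` for `k ≥ k₀` (`b ≥ 0`) gives
`b^m θ(Λ^k₀) ≤ θ(Λ^(k₀+m))` for every `m`. [folklore] -/
private theorem stub_exponentOfBlocks_aux_iterLower {θ : ℕ → ℝ} {Λ k₀ : ℕ} {b : ℝ} (hb : 0 ≤ b)
    (h : ∀ k : ℕ, k₀ ≤ k → b * θ (Λ ^ k) ≤ θ (Λ ^ (k + 1))) (m : ℕ) :
    b ^ m * θ (Λ ^ k₀) ≤ θ (Λ ^ (k₀ + m)) := by
  induction m with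
  | zero => simp
  | succ m ih =>
    calc b ^ (m + 1) * θ (Λ ^ k₀) = b * (b ^ m * θ (Λ ^ k₀)) := by rw [pow_succ]; ring
      _ ≤ b * θ (Λ ^ (k₀ + m)) := mul_le_mul_of_nonneg_left ih hb
      _ ≤ θ (Λ ^ (k₀ + m + 1)) := h _ (Nat.le_add_right _ _)
      _ = θ (Λ ^ (k₀ + (m + 1))) := by rw [add_assoc]

/-! ## Transfer to all `n` by monotonicity -/

/-- Transfer of the upper geometric bound to all `n ≥ 1` (antitone `θ ≤ 1`, `q > 0`):
`θ n ≤ q ^ ⌊(log n - k₀ log Λ) / log Λ⌋₊`. If `log n / log Λ < k₀` the exponent is `0`; otherwise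
`M = ⌊log n / log Λ - k₀⌋₊` satisfies `Λ^(k₀+M) ≤ n`, so `θ n ≤ θ(Λ^(k₀+M)) ≤ q^M θ(Λ^k₀) ≤ q^M`.
[folklore] -/
private theorem stub_exponentOfBlocks_aux_keyUpper {θ : ℕ → ℝ} (hθ1 : ∀ n, θ n ≤ 1)
    (hanti : Antitone θ) {Λ k₀ : ℕ} (hΛ : 2 ≤ Λ) {q : ℝ} (hq : 0 < q)
    (h : ∀ k : ℕ, k₀ ≤ k → θ (Λ ^ (k + 1)) ≤ q * θ (Λ ^ k)) (n : ℕ) (hn : 1 ≤ n) :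
    θ n ≤ q ^ ⌊(Real.log n - k₀ * Real.log Λ) / Real.log Λ⌋₊ := by
  have hΛ1 : (1 : ℝ) < Λ := by exact_mod_cast hΛ
  have hΛpos : (0 : ℝ) < Λ := by linarith
  have hlogΛ : 0 < Real.log Λ := Real.log_pos hΛ1
  have hnpos : (0 : ℝ) < n := by exact_mod_cast hn
  rcases lt_or_ge ((Real.log n - k₀ * Real.log Λ) / Real.log Λ) 0 with hx0 | hx0
  · rw [Nat.floor_of_nonpos hx0.le, pow_zero]
    exact hθ1 n
  · obtain ⟨M, hM⟩ : ∃ M : ℕ, ⌊(Real.log n - k₀ * Real.log Λ) / Real.log Λ⌋₊ = M := ⟨_, rfl⟩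
    have hMx : (M : ℝ) ≤ (Real.log n - k₀ * Real.log Λ) / Real.log Λ := hM ▸ Nat.floor_le hx0
    rw [le_div_iff₀ hlogΛ] at hMx
    have hlog : ((k₀ + M : ℕ) : ℝ) * Real.log Λ ≤ Real.log n := by
      push_cast
      linarith
    have hpow : (Λ : ℝ) ^ (k₀ + M) ≤ n := pow_le_of_mul_log_le_log hΛpos hnpos hlog
    have hnat : Λ ^ (k₀ + M) ≤ n := by exact_mod_cast hpow
    rw [hM]
    calc θ n ≤ θ (Λ ^ (k₀ + M)) := hanti hnat
      _ ≤ q ^ M * θ (Λ ^ k₀) := stub_exponentOfBlocks_aux_iterUpper hq.le h M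
      _ ≤ q ^ M * 1 := mul_le_mul_of_nonneg_left (hθ1 _) (pow_nonneg hq.le _)
      _ = q ^ M := mul_one _

/-- Transfer of the lower geometric bound to all `n ≥ 1` (antitone `θ > 0`, `0 < b ≤ 1`):
`θ(Λ^k₀) · b ^ ⌈log n / log Λ⌉₊ ≤ θ n`. With `N = ⌈log n / log Λ⌉₊` one has `n ≤ Λ^N`, hence
`θ n ≥ θ(Λ^N)`, and `θ(Λ^N) ≥ b^N θ(Λ^k₀)` both when `N = k₀ + m` (`b^N ≤ b^m`) and when `N < k₀`
(`θ(Λ^N) ≥ θ(Λ^k₀)`, `b^N ≤ 1`). [folklore] -/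
private theorem stub_exponentOfBlocks_aux_keyLower {θ : ℕ → ℝ} (hθ0 : ∀ n, 0 < θ n)
    (hanti : Antitone θ) {Λ k₀ : ℕ} (hΛ : 2 ≤ Λ) {b : ℝ} (hb0 : 0 < b) (hb1 : b ≤ 1)
    (h : ∀ k : ℕ, k₀ ≤ k → b * θ (Λ ^ k) ≤ θ (Λ ^ (k + 1))) (n : ℕ) (hn : 1 ≤ n) :
    θ (Λ ^ k₀) * b ^ ⌈Real.log n / Real.log Λ⌉₊ ≤ θ n := by
  have hΛ1 : (1 : ℝ) < Λ := by exact_mod_cast hΛ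
  have hΛpos : (0 : ℝ) < Λ := by linarith
  have hlogΛ : 0 < Real.log Λ := Real.log_pos hΛ1
  have hnpos : (0 : ℝ) < n := by exact_mod_cast hn
  obtain ⟨N, hN⟩ : ∃ N : ℕ, ⌈Real.log n / Real.log Λ⌉₊ = N := ⟨_, rfl⟩
  have hNx : Real.log n / Real.log Λ ≤ N := hN ▸ Nat.le_ceil _
  rw [div_le_iff₀ hlogΛ] at hNx
  have hpow : (n : ℝ) ≤ (Λ : ℝ) ^ N := le_pow_of_log_le_mul_log hΛpos hnpos hNx
  have hnat : n ≤ Λ ^ N := by exact_mod_cast hpow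
  have hp₀ : 0 < θ (Λ ^ k₀) := hθ0 _
  rw [hN]
  refine le_trans ?_ (hanti hnat)
  rcases le_or_gt k₀ N with hk | hk
  · obtain ⟨m, hm⟩ := Nat.exists_eq_add_of_le hk
    rw [hm]
    calc θ (Λ ^ k₀) * b ^ (k₀ + m) ≤ θ (Λ ^ k₀) * b ^ m :=
          mul_le_mul_of_nonneg_left (pow_le_pow_of_le_one hb0.le hb1 (Nat.le_add_left m k₀))
            hp₀.le
      _ = b ^ m * θ (Λ ^ k₀) := mul_comm _ _
      _ ≤ θ (Λ ^ (k₀ + m)) := stub_exponentOfBlocks_aux_iterLower hb0.le h m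
  · have hΛN : Λ ^ N ≤ Λ ^ k₀ := Nat.pow_le_pow_right (by omega) hk.le
    calc θ (Λ ^ k₀) * b ^ N ≤ θ (Λ ^ k₀) * 1 :=
          mul_le_mul_of_nonneg_left (pow_le_one₀ hb0.le hb1) hp₀.le
      _ = θ (Λ ^ k₀) := mul_one _
      _ ≤ θ (Λ ^ N) := hanti hΛN

/-! ## The exponent -/

/-- STUB (analysis) `stub_exponentOfBlocks`: if `θ : ℕ → ℝ` is positive, `≤ 1` and antitone, and
for every `δ > 0` there are a scale `Λ ≥ 2` and eventual one-step bounds along `Λ^k`,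
`θ(Λ^(k+1)) ≤ q θ(Λ^k)` with `log q ≤ (-β + δ) log Λ` and `b θ(Λ^k) ≤ θ(Λ^(k+1))` with
`(-β - δ) log Λ ≤ log b` (`0 < b ≤ 1`), then `log θ(n) / log n → -β`. Model-free conclusion of the
Smirnov–Werner scheme; both halves are the geometric-scale lemmas of LSW 2002, §3, after iterating
the one-step bounds and transferring them to all `n` by monotonicity. [folklore] -/
theorem stub_exponentOfBlocks : ∀ (θ : ℕ → ℝ) (β : ℝ), 0 < β → (∀ n, 0 < θ n) → (∀ n, θ n ≤ 1) → Antitone θ → (∀ δ : ℝ, 0 < δ → ∃ Λ : ℕ, 2 ≤ Λ ∧ ∃ q : ℝ, 0 < q ∧ Real.log q ≤ (-β + δ) * Real.log Λ ∧ ∃ k₀ : ℕ, ∀ k : ℕ, k₀ ≤ k → θ (Λ ^ (k + 1)) ≤ q * θ (Λ ^ k)) → (∀ δ : ℝ, 0 < δ → ∃ Λ : ℕ, 2 ≤ Λ ∧ ∃ b : ℝ, 0 < b ∧ b ≤ 1 ∧ (-β - δ) * Real.log Λ ≤ Real.log b ∧ ∃ k₀ : ℕ, ∀ k : ℕ, k₀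 ≤ k → b * θ (Λ ^ k) ≤ θ (Λ ^ (k + 1))) → Tendsto (fun n : ℕ ↦ Real.log (θ n) / Real.log n) atTop (𝓝 (-β)) := by
  intro θ β hβ hθ0 hθ1 hanti hupper hlower
  rw [tendsto_order]
  refine ⟨fun a ha ↦ ?_, fun a ha ↦ ?_⟩
  · -- lower half: `a < -β`; blocks at precision `δ = (-β - a)/2`
    obtain ⟨Λ, hΛ, b, hb0, hb1, hslope, k₀, hk⟩ := hlower ((-β - a) / 2) (by linarith)
    have hΛ1 : (1 : ℝ) < Λ := by exact_mod_cast hΛ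
    refine eventually_lt_log_div_log_of_geometric (hθ0 _) hb0 hb1 hΛ1 (δ := (-β - a) / 2)
      (by linarith) ?_ (stub_exponentOfBlocks_aux_keyLower hθ0 hanti hΛ hb0 hb1 hk)
    convert hslope using 2
    ring
  · -- upper half: `-β < a`; blocks at precision `δ = min ((a + β)/2) (β/2)`
    obtain ⟨Λ, hΛ, q, hq, hslope, k₀, hk⟩ :=
      hupper (min ((a + β) / 2) (β / 2)) (lt_min (by linarith) (by linarith))
    have hΛ1 : (1 : ℝ) < Λ := by exact_mod_cast hΛ
    have hm1 : min ((a + β) / 2) (β / 2) ≤ (a + β) / 2 := min_le_left _ _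
    have hm2 : min ((a + β) / 2) (β / 2) ≤ β / 2 := min_le_right _ _
    refine eventually_log_div_log_lt_of_geometric hθ0 hΛ1
      (δ := a + β - min ((a + β) / 2) (β / 2)) (C := k₀ * Real.log Λ) (by linarith) (by linarith)
      ?_ (stub_exponentOfBlocks_aux_keyUpper hθ1 hanti hΛ hq hk)
    convert hslope using 2
    ring

end OneArm

end Summit.CriticalPhenomena.CardyFormulaZ2.Cruxes.HalfPlaneMarkDensityLaw.SketchLine

end
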